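import Summits.Ventures.WeilGRH.FlatWindowConstantsExact
import Summits.Ventures.WeilGRH.ZetaFlatTest
import Summits.Ventures.WeilGRH.TwistedModulationCost
import Literature.NumberTheory.LFunctions.ExplicitFormulaPsiOne
import Literature.NumberTheory.LFunctions.RiemannXiLogDeriv
import HarnessLib

/-!
# GRH arm (rh-explicit, venture WeilGRH): the flat-window constants AT THE CENTRAL POINT —
  `K_κ = −2·(Γ_ℝ′/Γ_ℝ)(½ + κ)` and `K₀ = 2·ζ′(½)/ζ(½)`

Cell `rh-explicit`, WEIL TRACK (structure seat weil-3, gen8).  Sequel of `FlatWindowConstantsExact.lean`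
(`K₀ = log 8π + γ + π/2 = log π − ψ(¼)`, `K₁ = log 8π + γ − π/2 = log π − ψ(¾)`).  The archimedean
constants of the flat-window inequality are CENTRAL VALUES of logarithmic derivatives:

* `flatWindow_const_zero_eq_neg_two_mul_logDeriv_Gammaℝ`, `…_one_…`:
  `K_κ = −2·(Γ_ℝ′/Γ_ℝ)(½ + κ)` (`Γ_ℝ(s) = π^{−s/2}Γ(s/2)`; `κ = 0` even, `κ = 1` odd) — minus twice the
  logarithmic derivative of the archimedean `Γ`-factor of the `L`-function of parity `κ` at the central
  point `s = ½`;
* `deriv_riemannZeta_one_half_div`: **`ζ′(½)/ζ(½) = (log 8π + γ + π/2)/2`** (`= 2.68609…`), from the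
  functional equation (`ξ′/ξ(½) = 0`, `logDeriv_riemannXi_one_half`) and
  `ζ′/ζ = ξ′/ξ − 1/s − 1/(s−1) − Γ_ℝ′/Γ_ℝ` (`PsiOneExplicit.logDeriv_riemannZeta_eq_logDeriv_riemannXi`, with
  `ζ(½) < 0`); hence `flatWindow_const_zero_eq_two_mul_logDeriv_zeta`: **`K₀ = 2·ζ′(½)/ζ(½)`**.

Reading: the flat-window inequality `2Σ_{log n<2a}Λ(n)n^{-1/2}(1 − log n/(2a))Re χ(n) + K_κ − I_κ(a)/a ≤ log q`
(`TwistedFlatTest.lean`) compares the smoothed prime sum with `log q − K_κ = log q + 2(Γ_ℝ′/Γ_ℝ)(½+κ)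
= −2·Re[(Λ′/Λ)(½, χ) − (L′/L)(½, χ)]`-type central quantities: under GRH the explicit formula gives
`2Σ_{n<x}Λ(n)χ(n)n^{-1/2}(1 − log n/log x) → −2(L′/L)(½, χ) = log(q/π) − ψ((2κ+1)/4)·… = log q − K_κ`, so the
flat window is asymptotically extremal (WEIL3-STRUCTURE §15.2 (vi), argued); here only the identification
of the constants is typed.  Odlyzko's GRH discriminant constants are therefore
`8πe^{γ+π/2} = e^{2ζ′(½)/ζ(½)} = e^{−2(Γ_ℝ′/Γ_ℝ)(½)}` and `8πe^γ = e^{−(Γ_ℝ′/Γ_ℝ)(½) − (Γ_ℝ′/Γ_ℝ)(3/2)}`.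

No definitions, no named facts, RH/GRH-free.

## References

* E. C. Titchmarsh, *The Theory of the Riemann Zeta-function* (1986), §2.1, §2.12 (`ξ`, `ζ(½) < 0`).
  [Titchmarsh1986]
* A. M. Odlyzko, *Bounds for discriminants …: a survey of recent results*, Sém. Théor. Nombres Bordeaux 2
  (1990) 119–141, (2.5)–(2.8). [Odlyzko1990Bounds]
-/

set_option autoImplicit false

noncomputable section

open Complex Filter Set MeasureTheory
open scoped Real Topology ArithmeticFunction.vonMangoldt

namespace Summit.Ventures.WeilGRH

open Literature.NumberTheory.LFunctions

/-! ## `Γ_ℝ′/Γ_ℝ` at `½` and `3/2` -/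

/-- `(Γ_ℝ′/Γ_ℝ)(½) = −(log π)/2 + ψ(¼)/2 = −(log 8π + γ + π/2)/2`. -/
theorem logDeriv_Gammaℝ_one_half :
    logDeriv Gammaℝ (1 / 2) = -(((Real.log (8 * π) + Real.eulerMascheroniConstant + π / 2) / 2 : ℝ) : ℂ) := by
  have hpole : ∀ m : ℕ, (1 / 2 : ℂ) / 2 ≠ -m := fun m h ↦ by
    have := congrArg Complex.re h
    simp at this
    have hm : (0 : ℝ) ≤ m := m.cast_nonneg
    linarith
  rw [Literature.NumberTheory.LFunctions.logDeriv_Gammaℝ hpole, show (1 / 2 : ℂ) / 2 = 1 / 4 by norm_num,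
    Literature.Analysis.SpecialFunctions.Complex.digamma_one_quarter_eq_neg_ofReal,
    ← Complex.ofReal_log Real.pi_pos.le,
    show Real.log (8 * π) = 3 * Real.log 2 + Real.log π by
      rw [Real.log_mul (by norm_num) Real.pi_pos.ne', show (8 : ℝ) = 2 ^ 3 by norm_num, Real.log_pow]
      push_cast; ring]
  push_cast
  ring

/-- `(Γ_ℝ′/Γ_ℝ)(3/2) = −(log π)/2 + ψ(¾)/2 = −(log 8π + γ − π/2)/2`. -/
theorem logDeriv_Gammaℝ_three_halves :
    logDeriv Gammaℝ (3 / 2) = -(((Real.log (8 * π) + Real.eulerMascheroniConstant - π / 2) / 2 : ℝ) : ℂ) := by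
  have hpole : ∀ m : ℕ, (3 / 2 : ℂ) / 2 ≠ -m := fun m h ↦ by
    have := congrArg Complex.re h
    simp at this
    have hm : (0 : ℝ) ≤ m := m.cast_nonneg
    linarith
  have h2 : Complex.log 2 = ((Real.log 2 : ℝ) : ℂ) := by rw [Complex.ofReal_log zero_le_two]; norm_num
  rw [Literature.NumberTheory.LFunctions.logDeriv_Gammaℝ hpole, show (3 / 2 : ℂ) / 2 = 3 / 4 by norm_num,
    Literature.Analysis.SpecialFunctions.Complex.digamma_three_quarters, ← Complex.ofReal_log Real.pi_pos.le,
    h2,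
    show Real.log (8 * π) = 3 * Real.log 2 + Real.log π by
      rw [Real.log_mul (by norm_num) Real.pi_pos.ne', show (8 : ℝ) = 2 ^ 3 by norm_num, Real.log_pow]
      push_cast; ring]
  push_cast
  ring

/-- **`K₀ = −2·(Γ_ℝ′/Γ_ℝ)(½)`**: the even flat-window constant is minus twice the logarithmic derivative of
the even archimedean factor `Γ_ℝ(s) = π^{−s/2}Γ(s/2)` at the central point. -/
theorem flatWindow_const_zero_eq_neg_two_mul_logDeriv_Gammaℝ :
    ((Real.log (4 * π) + Real.eulerMascheroniConstant +
        2 * ∫ t in Ioi (0 : ℝ), weilKillingDensityPar 0 t : ℝ) : ℂ) = -2 * logDeriv Gammaℝ (1 / 2) := by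
  rw [flatWindow_const_zero_eq, logDeriv_Gammaℝ_one_half]
  push_cast
  ring

/-- **`K₁ = −2·(Γ_ℝ′/Γ_ℝ)(3/2)`**: the odd flat-window constant is minus twice the logarithmic derivative
of the odd archimedean factor `Γ_ℝ(s+1)` at the central point `s = ½`. -/
theorem flatWindow_const_one_eq_neg_two_mul_logDeriv_Gammaℝ :
    ((Real.log (4 * π) + Real.eulerMascheroniConstant +
        2 * ∫ t in Ioi (0 : ℝ), weilKillingDensityPar 1 t : ℝ) : ℂ) = -2 * logDeriv Gammaℝ (3 / 2) := by
  rw [flatWindow_const_one_eq, logDeriv_Gammaℝ_three_halves]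
  push_cast
  ring

/-! ## `ζ′(½)/ζ(½)` -/

/-- **`ξ′/ξ(½) = 0`** (the functional equation `ξ′/ξ(1 − s) = −ξ′/ξ(s)` at its centre). -/
theorem logDeriv_riemannXi_one_half : logDeriv riemannXi (1 / 2) = 0 := by
  have h := logDeriv_riemannXi_one_sub (1 / 2 : ℂ)
  rw [show (1 : ℂ) - 1 / 2 = 1 / 2 by norm_num] at h
  have : (2 : ℂ) * logDeriv riemannXi (1 / 2) = 0 := by rw [two_mul]; nth_rw 1 [h]; ring
  simpa using this

open scoped ComplexOrder in
/-- **`ζ′(½)/ζ(½) = (log 8π + γ + π/2)/2`** (`= 2.68609…`) as a COMPLEX identity: by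
`ζ′/ζ = ξ′/ξ − 1/s − 1/(s−1) − Γ_ℝ′/Γ_ℝ` at `s = ½`, where `ξ′/ξ(½) = 0`, `−1/s − 1/(s−1) = 0` and
`−Γ_ℝ′/Γ_ℝ(½) = (log π − ψ(¼))/2`; `ζ(½) ≠ 0` because `ζ < 0` on `(0,1)` (`riemannZeta_neg_of_pos_of_lt_one`;
landed also as `Literature.NumberTheory.LFunctions.riemannZeta_one_half_ne_zero`).  Unconditional (functional
equation + Gauss's `ψ(¼)`); the real part is `PfPersistenceF1CriticalLine.re_logDeriv_riemannZeta_one_half`. -/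
theorem deriv_riemannZeta_one_half_div :
    deriv riemannZeta (1 / 2) / riemannZeta (1 / 2) =
      (((Real.log (8 * π) + Real.eulerMascheroniConstant + π / 2) / 2 : ℝ) : ℂ) := by
  have hζ : riemannZeta (1 / 2) ≠ 0 := by
    have h := riemannZeta_neg_of_pos_of_lt_one (σ := 1 / 2) (by norm_num) (by norm_num)
    rw [show (((1 / 2 : ℝ)) : ℂ) = 1 / 2 by push_cast; ring] at h
    exact h.ne
  rw [PsiOneExplicit.logDeriv_riemannZeta_eq_logDeriv_riemannXi (s := 1 / 2) (by norm_num) (by norm_num)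
      (by norm_num) hζ,
    logDeriv_riemannXi_one_half, logDeriv_Gammaℝ_one_half]
  ring

/-- **`K₀ = 2·ζ′(½)/ζ(½)`**: the even flat-window constant — the logarithm of Odlyzko's totally real GRH
discriminant constant `8πe^{γ+π/2}` — is twice the logarithmic derivative of `ζ` at the central point. -/
theorem flatWindow_const_zero_eq_two_mul_logDeriv_zeta :
    ((Real.log (4 * π) + Real.eulerMascheroniConstant +
        2 * ∫ t in Ioi (0 : ℝ), weilKillingDensityPar 0 t : ℝ) : ℂ) =
      2 * (deriv riemannZeta (1 / 2) / riemannZeta (1 / 2)) := by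
  rw [deriv_riemannZeta_one_half_div, flatWindow_const_zero_eq]
  push_cast
  ring

/-- **Odlyzko's totally real constant through `ζ`**: `8π·e^γ·e^{π/2} = exp(2·Re ζ′(½)/ζ(½))`. -/
theorem odlyzko_real_const_eq_exp_logDeriv_zeta :
    8 * π * Real.exp Real.eulerMascheroniConstant * Real.exp (π / 2) =
      Real.exp (2 * (deriv riemannZeta (1 / 2) / riemannZeta (1 / 2)).re) := by
  rw [deriv_riemannZeta_one_half_div, Complex.ofReal_re, ← exp_flatWindow_const_zero, flatWindow_const_zero_eq]
  congr 1
  ring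

/-! ## The flat-window inequalities written with the central values -/

/-- **The `ζ` flat-window inequality at the central point**: for `a > 0`,
`WeilPositivityOn a ⟹ Σ_{log n<2a} Λ(n)n^{-1/2}(1 − log n/(2a)) ≤ 8 sinh²(a/2)/a − ζ′(½)/ζ(½) + I₀(a)/(2a)`
(`ZetaFlatTest.zetaFlatWindow_le_of_weilPositivityOn` with `K₀ = 2ζ′(½)/ζ(½)`).  Under RH the explicit formula
makes this an asymptotic equality: `Σ_{n<x}Λ(n)n^{-1/2}(1 − log n/log x) = 4√x/log x − ζ′(½)/ζ(½) + o(1)`. -/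
theorem zetaFlatSum_le_central {a : ℝ} (ha : 0 < a) (hW : WeilPositivityOn a) :
    ∑ n ∈ weilPrimeIndex a, (Λ n : ℝ) / Real.sqrt n * (1 - Real.log n / (2 * a)) ≤
      8 * Real.sinh (a / 2) ^ 2 / a - (deriv riemannZeta (1 / 2) / riemannZeta (1 / 2)).re +
        1 / (2 * a) * ∫ t in Ioi (0 : ℝ), weilArchDensityPar 0 t * min t (2 * a) := by
  have h := zetaFlatWindow_le_of_weilPositivityOn ha hW
  rw [show (fun t ↦ (Real.exp (t / 2) - 1) / (2 * Real.sinh t)) = fun t ↦ weilKillingDensityPar 0 t from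
      (funext weilKillingDensityPar_zero_eq).symm,
    show (fun t ↦ weilArchDensity t * min t (2 * a)) = fun t ↦ weilArchDensityPar 0 t * min t (2 * a) from
      funext fun t ↦ by rw [weilArchDensityPar_zero_apply], flatWindow_const_zero_eq] at h
  rw [deriv_riemannZeta_one_half_div, Complex.ofReal_re]
  have ha2 : 1 / (2 * a) * ∫ t in Ioi (0 : ℝ), weilArchDensityPar 0 t * min t (2 * a) =
      (1 / a * ∫ t in Ioi (0 : ℝ), weilArchDensityPar 0 t * min t (2 * a)) / 2 := by ring
  have hp : 8 * Real.sinh (a / 2) ^ 2 / a = (16 * Real.sinh (a / 2) ^ 2 / a) / 2 := by ring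
  rw [ha2, hp]
  linarith

/-- **The `χ` flat-window inequality at the central point**: for `χ` mod `q ≠ 1`, `a > 0`,
`WeilPositivityOnChar χ a ⟹ 2Σ_{log n<2a}Λ(n)n^{-1/2}(1 − log n/(2a))Re χ(n) ≤ log q + 2Re(Γ_ℝ′/Γ_ℝ)(½ + κ) + I_κ(a)/a`
— the conductor and the central archimedean log-derivative on the right are the two terms of
`−2Re(L′/L)(½, χ) = log(q/π) − ψ((2κ+1)/4)` that the explicit formula gives as the `x → ∞` limit under GRH. -/
theorem flatSum_le_central {q : ℕ} {a : ℝ} (hq : q ≠ 1) (χ : DirichletCharacter ℂ q) (ha : 0 < a)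
    (hW : WeilPositivityOnChar χ a) :
    2 * (∑ n ∈ weilPrimeIndex a,
          (Λ n : ℝ) / Real.sqrt n * ((1 - Real.log n / (2 * a)) * (χ (n : ZMod q)).re)) ≤
      Real.log q + 2 * (logDeriv Gammaℝ (1 / 2 + (charParity χ : ℂ))).re +
        1 / a * ∫ t in Ioi (0 : ℝ), weilArchDensityPar (charParity χ) t * min t (2 * a) := by
  have h := flatWindow_le_log_of_weilPositivityOnChar hq χ ha hW
  have hκ := charParity_le_one χ
  interval_cases hc : charParity χ
  · rw [flatWindow_const_zero_eq] at h
    rw [Nat.cast_zero, add_zero, logDeriv_Gammaℝ_one_half, Complex.neg_re, Complex.ofReal_re]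
    linarith
  · rw [flatWindow_const_one_eq] at h
    rw [Nat.cast_one, show (1 / 2 : ℂ) + 1 = 3 / 2 by norm_num, logDeriv_Gammaℝ_three_halves, Complex.neg_re,
      Complex.ofReal_re]
    linarith

end Summit.Ventures.WeilGRH

end
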